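import Summits.ResolutionOfSingularities.ResolutionOfSingularities.Theorems.FrobeniusLadderFInjectiveMacaulayficationSopFrobeniusPower
import Summits.ResolutionOfSingularities.ResolutionOfSingularities.Theorems.FrobeniusLadderFInjectiveMacaulayficationRegularPairFromTransversal
import Summits.ResolutionOfSingularities.ResolutionOfSingularities.Theorems.FrobeniusLadderFInjectiveMacaulayficationPencilIntegral
import Summits.ResolutionOfSingularities.ResolutionOfSingularities.Theorems.FrobeniusLadderFInjectiveMacaulayficationPencilQuotFinSucc
import HarnessLib

/-!
# Monomials in a regular system of parameters: primality of sub-systems, non-membership, and the REGULAR PAIRS `(ε·∏ sᵢ^{aᵢ}, v)` feeding the pencil charts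
# (BED Ω₁ GLOBAL PATCH, F6 v2 (d) «regular pair of germs from r.s.o.p. membership»; crux `FInjectiveMacaulayfication` stmt-ResolutionOfSingularities-15315, chain w45a;
# seat res-L1-w45a-stub-3 g15)

[OURS · L1 W4.5a] Support file (`--supports stmt-ResolutionOfSingularities-15315 --as helper`); theorems only; GENERIC commutative algebra; no named fact; NOT a statement of any
manuscript; nothing of the crux is proved. AI-written (AI review is weaker than expert review).

`(R, 𝔪)` regular local, `s` a list with `Ideal.ofList s = 𝔪` and `s.length = dim R` (a regular system of parameters), monomials `∏ s[i]^(e i)` (exponents by position).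
* §1 `quotient_span_isRegularLocalRing` / `isPrime_span_of_subset` — `R/(T)` is regular local, `(T)` is prime, for every `T ⊆ s`; `not_mem_span_of_not_mem` — a member of `s` outside
  `T` is not in `(T)` (Matsumura 14.2); `nodup`, `getElem_ne_zero`, `getElem_not_mem_span_getElem`.
* §2 `monomial_not_mem_span_getElem` — `∏ s[j]^(m j) ∉ (s[i])` when `m i = 0`; ★ `binomial_not_mem_span_getElem` — `ε₃·∏ s[j]^(b j) − ε₄·∏ s[j]^(c j) ∉ (s[i])` for units `ε₃, ε₄`,
  exponents `b ≠ c` on the positions, and `b i = 0 = c i` (UFD-free argument in the regular domain `R/(s[i])`).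
* §3 ★★ `dvd_of_monomial_dvd_mul` — `u = ε·∏ s[i]^(a i)`, `v ∉ (s[i])` whenever `a i ≠ 0` ⇒ `u ∣ r·v → u ∣ r` (✓ `RegularPairFromTransversal.nzdMod_prod_pow`); with
  ✓ `PencilQuotFinSucc.regularPair_symm` and ✓ `PencilIntegral.isDomain_pencilChart`: ★★ `pencil_pair_package` — `u ≠ 0`, `v ≠ 0`, both divisibility transfers, and BOTH pencil charts
  `R[X]/(uX − v)`, `R[X]/(vX − u)` are domains — the (d)-inputs of ✓ `PencilStalkOverPoint.fullCl_stalk_of_pair_germ_over`.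
[cite: Matsumura1987, Thm. 14.2, Thm. 14.3, Thm. 17.4]
-/

set_option linter.dupNamespace false

noncomputable section

namespace Summit.ResolutionOfSingularities.ResolutionOfSingularities.Theorems.FInjectiveMacaulayfication.RsopMonomialPairs

open IsLocalRing Polynomial Literature.AlgebraicGeometry.Resolution
open Summit.ResolutionOfSingularities.ResolutionOfSingularities.Theorems.FInjectiveMacaulayfication SopFrobeniusPower RegularPairFromTransversal

universe u

variable {R : Type u} [CommRing R] [IsRegularLocalRing R] (s : List R)
  (hspan : Ideal.ofList s = maximalIdeal R) (hlen : (s.length : WithBot ℕ∞) = ringKrullDim R)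

/-! ## §1 Sub-systems: regular quotients, primality, no redundancy -/

include hspan hlen in
/-- `R/(T)` is regular local for every `T ⊆ s`. [cite: Matsumura1987, Thm. 14.2] -/
theorem quotient_span_isRegularLocalRing [DecidableEq R] (T : Finset R) (hT : T ⊆ s.toFinset) :
    IsRegularLocalRing (R ⧸ Ideal.span (T : Set R)) := by
  have mem : ((s.toFinset : Finset R) : Set R) ⊆ maximalIdeal R := fun y hy => by
    rw [← hspan]; exact Ideal.subset_span (by simpa using hy)
  have hT' : ((T : Set R)) ⊆ maximalIdeal R := (Finset.coe_subset.mpr hT).trans mem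
  have h0 : ∃ T' : Finset R, T ⊆ T' ∧ (T'.card : WithBot ℕ∞) = ringKrullDim R ∧ Ideal.span (T' : Set R) = maximalIdeal R :=
    ⟨s.toFinset, hT, card_toFinset_eq s hspan hlen, by rw [← hspan, Ideal.ofList, List.coe_toFinset]⟩
  have h := ((quotient_isRegularLocalRing_tfae R T hT').out 0 2).mp h0
  exact h.1

include hspan hlen in
/-- `(T)` is prime for every `T ⊆ s`. [cite: Matsumura1987, Thm. 14.3] -/
theorem isPrime_span_of_subset [DecidableEq R] (T : Finset R) (hT : T ⊆ s.toFinset) : (Ideal.span (T : Set R)).IsPrime := by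
  haveI := quotient_span_isRegularLocalRing s hspan hlen T hT
  haveI := isDomain_of_isRegularLocalRing (R ⧸ Ideal.span (T : Set R))
  exact (Ideal.Quotient.isDomain_iff_prime _).mp ‹_›

include hspan hlen in
/-- No redundancy: a member of `s` outside `T ⊆ s` does not lie in `(T)`. [cite: Matsumura1987, Thm. 14.2] -/
theorem not_mem_span_of_not_mem [DecidableEq R] (y : R) (hy : y ∈ s) (T : Finset R) (hT : T ⊆ s.toFinset) (hyT : y ∉ T) :
    y ∉ Ideal.span (T : Set R) := by
  intro hmem
  have hsub : T ⊆ s.toFinset.erase y := fun z hz => Finset.mem_erase.mpr ⟨fun h => hyT (h ▸ hz), hT hz⟩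
  have heq : Ideal.span (((s.toFinset.erase y : Finset R)) : Set R) = maximalIdeal R := by
    apply le_antisymm
    · rw [← hspan, Ideal.ofList]
      exact Ideal.span_mono fun z hz => by
        have hz' := Finset.mem_coe.mp hz
        rw [Finset.mem_erase, List.mem_toFinset] at hz'
        exact hz'.2
    · rw [← hspan, Ideal.ofList, Ideal.span_le]
      intro z hz
      by_cases hzy : z = y
      · subst hzy
        exact Ideal.span_mono (Finset.coe_subset.mpr hsub) hmem
      · exact Ideal.subset_span (Finset.mem_coe.mpr (Finset.mem_erase.mpr ⟨hzy, List.mem_toFinset.mpr hz⟩))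
  have hle : (maximalIdeal R).spanFinrank ≤ (s.toFinset.erase y).card := by
    rw [← heq]
    refine (Submodule.spanFinrank_span_le_ncard_of_finite (Finset.finite_toSet _)).trans ?_
    rw [Set.ncard_coe_finset]
  have hcard : (s.toFinset.erase y).card + 1 = s.toFinset.card := Finset.card_erase_add_one (List.mem_toFinset.mpr hy)
  have hreg := (isRegularLocalRing_iff R).mp ‹_›
  have c := card_toFinset_eq s hspan hlen
  have h1 : ((maximalIdeal R).spanFinrank : WithBot ℕ∞) = (s.toFinset.card : WithBot ℕ∞) := by rw [hreg, c]
  have h2 : (maximalIdeal R).spanFinrank = s.toFinset.card := by exact_mod_cast h1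
  omega

include hspan hlen in
/-- A regular system of parameters of length `dim R` has no repeated member. [cite: Matsumura1987, Thm. 14.2] -/
theorem nodup [DecidableEq R] : s.Nodup := by
  have c := card_toFinset_eq s hspan hlen
  rw [← hlen] at c
  have c' : s.toFinset.card = s.length := by exact_mod_cast c
  have h := Multiset.toFinset_card_eq_card_iff_nodup (m := (s : Multiset R))
  rw [Multiset.coe_nodup, Multiset.coe_card] at h
  exact h.mp c'

include hspan hlen in
/-- Members of a regular system of parameters are non-zero. [plumbing] -/
theorem getElem_ne_zero (i : Fin s.length) : s[i] ≠ 0 := by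
  classical
  intro h0
  have := not_mem_span_of_not_mem s hspan hlen s[i] (List.getElem_mem i.2) ∅ (Finset.empty_subset _) (Finset.notMem_empty _)
  rw [Finset.coe_empty, Ideal.span_empty, h0] at this
  exact this (Submodule.zero_mem _)

include hspan hlen in
/-- `(s[i])` is a prime ideal. [cite: Matsumura1987, Thm. 14.3] -/
theorem isPrime_span_getElem (i : Fin s.length) : (Ideal.span {s[i]} : Ideal R).IsPrime := by
  classical
  have h := isPrime_span_of_subset s hspan hlen {s[i]} (Finset.singleton_subset_iff.mpr (List.mem_toFinset.mpr (List.getElem_mem i.2)))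
  rwa [Finset.coe_singleton] at h

include hspan hlen in
/-- `s[j] ∉ (s[i])` for `j ≠ i`. [cite: Matsumura1987, Thm. 14.2] -/
theorem getElem_not_mem_span_getElem (i j : Fin s.length) (hij : j ≠ i) : s[j] ∉ (Ideal.span {s[i]} : Ideal R) := by
  classical
  have hne : s[j] ≠ s[i] := fun h => hij (Fin.ext ((List.Nodup.getElem_inj_iff (nodup s hspan hlen)).mp h))
  have h := not_mem_span_of_not_mem s hspan hlen s[j] (List.getElem_mem j.2) {s[i]}
    (Finset.singleton_subset_iff.mpr (List.mem_toFinset.mpr (List.getElem_mem i.2))) (by rwa [Finset.mem_singleton])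
  rwa [Finset.coe_singleton] at h

include hspan hlen in
/-- `(s[i], s[j])` is a prime ideal. [cite: Matsumura1987, Thm. 14.3] -/
theorem isPrime_span_pair (i j : Fin s.length) : (Ideal.span {s[i], s[j]} : Ideal R).IsPrime := by
  classical
  have hsub : ({s[i], s[j]} : Finset R) ⊆ s.toFinset := by
    intro z hz
    rcases Finset.mem_insert.mp hz with rfl | hz
    · exact List.mem_toFinset.mpr (List.getElem_mem i.2)
    · rw [Finset.mem_singleton] at hz; subst hz; exact List.mem_toFinset.mpr (List.getElem_mem j.2)
  have h := isPrime_span_of_subset s hspan hlen {s[i], s[j]} hsub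
  rwa [Finset.coe_insert, Finset.coe_singleton] at h

include hspan hlen in
/-- `s[l] ∉ (s[i], s[j])` for `l ≠ i, j`. [cite: Matsumura1987, Thm. 14.2] -/
theorem getElem_not_mem_span_pair (i j l : Fin s.length) (hli : l ≠ i) (hlj : l ≠ j) : s[l] ∉ (Ideal.span {s[i], s[j]} : Ideal R) := by
  classical
  have hnd := nodup s hspan hlen
  have hsub : ({s[i], s[j]} : Finset R) ⊆ s.toFinset := by
    intro z hz
    rcases Finset.mem_insert.mp hz with rfl | hz
    · exact List.mem_toFinset.mpr (List.getElem_mem i.2)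
    · rw [Finset.mem_singleton] at hz; subst hz; exact List.mem_toFinset.mpr (List.getElem_mem j.2)
  have hnot : s[l] ∉ ({s[i], s[j]} : Finset R) := by
    rw [Finset.mem_insert, Finset.mem_singleton, not_or]
    exact ⟨fun h => hli (Fin.ext ((List.Nodup.getElem_inj_iff hnd).mp h)), fun h => hlj (Fin.ext ((List.Nodup.getElem_inj_iff hnd).mp h))⟩
  have h := not_mem_span_of_not_mem s hspan hlen s[l] (List.getElem_mem l.2) {s[i], s[j]} hsub hnot
  rwa [Finset.coe_insert, Finset.coe_singleton] at h

/-! ## §2 Monomials and binomials outside `(s[i])` -/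

include hspan hlen in
/-- `∏ s[j]^(m j) ∉ (s[i])` when `m i = 0`. [folklore] -/
theorem monomial_not_mem_span_getElem (m : ℕ → ℕ) (i : Fin s.length) (hi : m i = 0) :
    (∏ j : Fin s.length, s[j] ^ m j) ∉ (Ideal.span {s[i]} : Ideal R) := by
  classical
  haveI := isPrime_span_getElem s hspan hlen i
  intro h
  obtain ⟨j, -, hj⟩ := Ideal.IsPrime.prod_mem_iff.mp h
  have hmj : m j ≠ 0 := by
    intro h0
    rw [h0, pow_zero] at hj
    exact Ideal.IsPrime.ne_top ‹_› ((Ideal.eq_top_iff_one _).mpr hj)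
  have hji : j ≠ i := by
    intro hji
    apply hmj
    have : (m j : ℕ) = m i := by rw [hji]
    rw [this, hi]
  exact getElem_not_mem_span_getElem s hspan hlen i j hji (Ideal.IsPrime.mem_of_pow_mem ‹_› _ hj)

include hspan hlen in
/-- One direction of the binomial lemma: if `ε₃·∏ s[l]^(b l) − ε₄·∏ s[l]^(c l) ∈ (s[i])` with `b i = 0 = c i` and `b j < c j` for some `j`, contradiction. [folklore] -/
theorem binomial_not_mem_span_getElem_of_lt (b c : ℕ → ℕ) (i j : Fin s.length) (hbi : b i = 0) (hci : c i = 0) (hj : b j < c j)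
    (ε₃ ε₄ : R) (hε₃ : IsUnit ε₃) :
    ε₃ * (∏ l : Fin s.length, s[l] ^ b l) - ε₄ * (∏ l : Fin s.length, s[l] ^ c l) ∉ (Ideal.span {s[i]} : Ideal R) := by
  classical
  have hji : j ≠ i := by rintro rfl; omega
  intro hmem
  -- `∏ s^b ∈ (s[i], s[j]^(b j + 1))`
  have hc' : (∏ l : Fin s.length, s[l] ^ c l) ∈ (Ideal.span {s[j] ^ (b j + 1)} : Ideal R) := by
    rw [← Finset.mul_prod_erase Finset.univ (fun l : Fin s.length => s[l] ^ c l) (Finset.mem_univ j)]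
    refine Ideal.mul_mem_right _ _ (Ideal.mem_span_singleton.mpr (pow_dvd_pow _ hj))
  have hb' : (∏ l : Fin s.length, s[l] ^ b l) ∈ (Ideal.span {s[i]} : Ideal R) ⊔ Ideal.span {s[j] ^ (b j + 1)} := by
    have h1 : ε₃ * (∏ l : Fin s.length, s[l] ^ b l) ∈ (Ideal.span {s[i]} : Ideal R) ⊔ Ideal.span {s[j] ^ (b j + 1)} := by
      have : ε₃ * (∏ l : Fin s.length, s[l] ^ b l) = (ε₃ * (∏ l : Fin s.length, s[l] ^ b l) - ε₄ * (∏ l : Fin s.length, s[l] ^ c l)) +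
          ε₄ * (∏ l : Fin s.length, s[l] ^ c l) := by ring
      rw [this]
      exact Submodule.add_mem _ (Ideal.mem_sup_left hmem) (Ideal.mem_sup_right (Ideal.mul_mem_left _ _ hc'))
    exact (Submodule.smul_mem_iff_of_isUnit _ hε₃).mp h1
  -- write `∏ s^b = s[j]^(b j) · M′`
  set M' : R := ∏ l ∈ (Finset.univ : Finset (Fin s.length)).erase j, s[l] ^ b l with hM'
  have hprod : (∏ l : Fin s.length, s[l] ^ b l) = s[j] ^ b j * M' := by
    rw [hM', Finset.mul_prod_erase Finset.univ (fun l : Fin s.length => s[l] ^ b l) (Finset.mem_univ j)]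
  rw [hprod] at hb'
  -- in the domain `R/(s[i])`: cancel `s[j]^(b j)`
  haveI hPi := isPrime_span_getElem s hspan hlen i
  haveI : IsDomain (R ⧸ (Ideal.span {s[i]} : Ideal R)) := Ideal.Quotient.isDomain _
  set π := Ideal.Quotient.mk (Ideal.span {s[i]} : Ideal R) with hπ
  have hsj0 : π s[j] ≠ 0 := by
    rw [hπ, Ne, Ideal.Quotient.eq_zero_iff_mem]
    exact getElem_not_mem_span_getElem s hspan hlen i j hji
  obtain ⟨x, hx, y, hy, hxy⟩ := Submodule.mem_sup.mp hb'
  obtain ⟨t, rfl⟩ := Ideal.mem_span_singleton'.mp hy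
  have hx0 : π x = 0 := Ideal.Quotient.eq_zero_iff_mem.mpr hx
  have key : π s[j] ^ b j * π M' = π s[j] ^ b j * (π s[j] * π t) := by
    have := congrArg π hxy
    rw [map_add, hx0, zero_add, map_mul, map_pow, map_mul, map_pow, pow_succ] at this
    rw [← this]; ring
  have hM'mem : π M' = π s[j] * π t := mul_left_cancel₀ (pow_ne_zero _ hsj0) key
  -- so `M′ ∈ (s[i], s[j])`, a prime ideal missing every other member of `s`
  have hM'2 : M' ∈ (Ideal.span {s[i], s[j]} : Ideal R) := by
    have h1 : M' - s[j] * t ∈ (Ideal.span {s[i]} : Ideal R) := by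
      rw [← Ideal.Quotient.eq_zero_iff_mem, map_sub, map_mul, hM'mem, sub_self]
    have h2 : M' = (M' - s[j] * t) + s[j] * t := by ring
    rw [h2, Ideal.span_insert]
    exact Submodule.add_mem _ (Ideal.mem_sup_left h1) (Ideal.mem_sup_right (Ideal.mul_mem_right _ _ (Ideal.mem_span_singleton_self _)))
  haveI := isPrime_span_pair s hspan hlen i j
  rw [hM'] at hM'2
  obtain ⟨l, hl, hl'⟩ := Ideal.IsPrime.prod_mem_iff.mp hM'2
  have hlj : l ≠ j := (Finset.mem_erase.mp hl).1
  have hbl : b l ≠ 0 := by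
    intro h0
    rw [h0, pow_zero] at hl'
    exact Ideal.IsPrime.ne_top ‹_› ((Ideal.eq_top_iff_one _).mpr hl')
  have hli : l ≠ i := by
    intro hli
    apply hbl
    have : (b l : ℕ) = b i := by rw [hli]
    rw [this, hbi]
  exact getElem_not_mem_span_pair s hspan hlen i j l hli hlj (Ideal.IsPrime.mem_of_pow_mem ‹_› _ hl')

include hspan hlen in
/-- ★ **`ε₃·∏ s[l]^(b l) − ε₄·∏ s[l]^(c l) ∉ (s[i])`** for units `ε₃, ε₄`, position exponents `b ≠ c` (on `Fin s.length`) with `b i = 0 = c i`. [folklore] -/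
theorem binomial_not_mem_span_getElem (b c : ℕ → ℕ) (i : Fin s.length) (hbi : b i = 0) (hci : c i = 0) (hbc : ∃ j : Fin s.length, b j ≠ c j)
    (ε₃ ε₄ : R) (hε₃ : IsUnit ε₃) (hε₄ : IsUnit ε₄) :
    ε₃ * (∏ l : Fin s.length, s[l] ^ b l) - ε₄ * (∏ l : Fin s.length, s[l] ^ c l) ∉ (Ideal.span {s[i]} : Ideal R) := by
  obtain ⟨j, hj⟩ := hbc
  rcases Nat.lt_or_gt_of_ne hj with h | h
  · exact binomial_not_mem_span_getElem_of_lt s hspan hlen b c i j hbi hci h ε₃ ε₄ hε₃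
  · intro hmem
    apply binomial_not_mem_span_getElem_of_lt s hspan hlen c b i j hci hbi h ε₄ ε₃ hε₄
    have : ε₄ * (∏ l : Fin s.length, s[l] ^ c l) - ε₃ * (∏ l : Fin s.length, s[l] ^ b l) =
        -(ε₃ * (∏ l : Fin s.length, s[l] ^ b l) - ε₄ * (∏ l : Fin s.length, s[l] ^ c l)) := by ring
    rw [this]
    exact Submodule.neg_mem _ hmem

/-! ## §3 Regular pairs `(ε·∏ s[i]^(a i), v)` and the two pencil charts -/

include hspan hlen in
/-- ★★ **`u = ε·∏ s[i]^(a i)` divides `r` as soon as it divides `r·v`**, provided `v ∉ (s[i])` for every position `i` with `a i ≠ 0`. [cite: Matsumura1987, Thm. 17.4] -/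
theorem dvd_of_monomial_dvd_mul (a : ℕ → ℕ) (ε : R) (hε : IsUnit ε) (v : R) (hv : ∀ i : Fin s.length, a i ≠ 0 → v ∉ (Ideal.span {s[i]} : Ideal R)) :
    ∀ r : R, ε * (∏ i : Fin s.length, s[i] ^ a i) ∣ r * v → ε * (∏ i : Fin s.length, s[i] ^ a i) ∣ r := by
  classical
  haveI : IsDomain R := isDomain_of_isRegularLocalRing R
  -- drop the positions with `a i = 0`
  have hprod : (∏ i : Fin s.length, s[i] ^ a i) = ∏ i ∈ Finset.univ.filter (fun i : Fin s.length => a i ≠ 0), s[i] ^ a i := by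
    rw [Finset.prod_filter]
    refine Finset.prod_congr rfl fun i _ => ?_
    split_ifs with h
    · rfl
    · rw [not_not.mp h, pow_zero]
  rw [hprod]
  refine nzdMod_unit_mul ε hε (nzdMod_prod_pow _ (fun i : Fin s.length => s[i]) (fun i : Fin s.length => a i) v
    (fun i _ => mem_nonZeroDivisors_of_ne_zero (getElem_ne_zero s hspan hlen i)) fun i hi => ?_)
  haveI := isPrime_span_getElem s hspan hlen i
  haveI : IsDomain (R ⧸ (Ideal.span {s[i]} : Ideal R)) := Ideal.Quotient.isDomain _
  exact nzdMod_of_quotient_isDomain s[i] v (hv i (Finset.mem_filter.mp hi).2)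

end Summit.ResolutionOfSingularities.ResolutionOfSingularities.Theorems.FInjectiveMacaulayfication.RsopMonomialPairs

namespace Summit.ResolutionOfSingularities.ResolutionOfSingularities.Theorems.FInjectiveMacaulayfication.RsopMonomialPairs

open IsLocalRing Polynomial Literature.AlgebraicGeometry.Resolution
open Summit.ResolutionOfSingularities.ResolutionOfSingularities.Theorems.FInjectiveMacaulayfication SopFrobeniusPower RegularPairFromTransversal

variable {R : Type} [CommRing R] [IsRegularLocalRing R] (s : List R)
  (hspan : Ideal.ofList s = maximalIdeal R) (hlen : (s.length : WithBot ℕ∞) = ringKrullDim R)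

include hspan hlen in
/-- ★★ **THE (d)-PACKAGE OF A MONOMIAL PENCIL PAIR.** `u = ε·∏ s[i]^(a i)` (`ε` a unit), `v ≠ 0` with `v ∉ (s[i])` whenever `a i ≠ 0`: then `u ≠ 0`, `u ∣ r v → u ∣ r`, `v ∣ r u → v ∣ r`,
and both pencil charts `R[X]/(uX − v)`, `R[X]/(vX − u)` are domains. [cite: Matsumura1987, Thm. 17.4] -/
theorem pencil_pair_package (a : ℕ → ℕ) (ε : R) (hε : IsUnit ε) (u v : R) (hu : u = ε * ∏ i : Fin s.length, s[i] ^ a i) (hv0 : v ≠ 0)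
    (hv : ∀ i : Fin s.length, a i ≠ 0 → v ∉ (Ideal.span {s[i]} : Ideal R)) :
    u ≠ 0 ∧ (∀ r : R, u ∣ r * v → u ∣ r) ∧ (∀ r : R, v ∣ r * u → v ∣ r) ∧
      IsDomain (R[X] ⧸ (Ideal.span {C u * X - C v} : Ideal R[X])) ∧ IsDomain (R[X] ⧸ (Ideal.span {C v * X - C u} : Ideal R[X])) := by
  haveI : IsDomain R := isDomain_of_isRegularLocalRing R
  have hu0 : u ≠ 0 := by
    rw [hu]
    exact mul_ne_zero hε.ne_zero (Finset.prod_ne_zero_iff.mpr fun i _ => pow_ne_zero _ (getElem_ne_zero s hspan hlen i))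
  have huv : ∀ r : R, u ∣ r * v → u ∣ r := by
    rw [hu]; exact dvd_of_monomial_dvd_mul s hspan hlen a ε hε v hv
  have hvu : ∀ r : R, v ∣ r * u → v ∣ r := PencilQuotFinSucc.regularPair_symm hu0 huv
  have hregW : ∀ t : R, v * t ∈ Ideal.span {u} → t ∈ Ideal.span {u} := fun t ht => by
    rw [Ideal.mem_span_singleton] at ht ⊢
    exact huv t (by rwa [mul_comm] at ht)
  have hregU : ∀ t : R, u * t ∈ Ideal.span {v} → t ∈ Ideal.span {v} := fun t ht => by
    rw [Ideal.mem_span_singleton] at ht ⊢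
    exact hvu t (by rwa [mul_comm] at ht)
  exact ⟨hu0, huv, hvu, PencilIntegral.isDomain_pencilChart u v hu0 hregW, PencilIntegral.isDomain_pencilChart v u hv0 hregU⟩

end Summit.ResolutionOfSingularities.ResolutionOfSingularities.Theorems.FInjectiveMacaulayfication.RsopMonomialPairs

end
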